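import Summits.HodgeConjecture.HodgeConjecture.Theorems.R90S5XiStringOfEnvelope              -- ★ (this seat) road γ: `xiString_eventually_clFinChoice_eq_recordπn_of_baseChange`; brings `xiFamilyOfRecord`, `clFinChoice`
import Summits.HodgeConjecture.HodgeConjecture.Theorems.F0P3XiLocalLabelsOfMemXiFamily       -- ★ `bc_localComponent_eq_of_mem_cmSplitPacket_members` (Zelevinsky rigidity of the split labels)
import Literature.NumberTheory.Rogawski1990.OneDimAutRepHSplitRigidityOffFinite              -- ★ p02 ROAD S: `OneDimAutRepH.ext_of_exists_bc_localComponent_eq_of_split_of_not_mem` (weak approximation off a finite set)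
import HarnessLib

/-!
# R90-TF · S5 «Ch. 13.3» — THE RECORD ξ-STRING DETERMINES `ξ`: `(v ↦ πⁿ(ξ_v)) = (v ↦ πⁿ(ξ′_v))` at all but finitely many `v` ⇒ `ξ = ξ′`
# (`Theorems/R90S5XiEqOfRecordStringEq.lean`; seat R90-C133-p03 (g0), self-dealt on the γ line — the `H`-side of «there exists a UNIQUE ξ such that t(Π′) = t(Π(ξ))», p. 244)

Cell `hodgecm-mathlib`, crux H413 (`stmt-HodgeConjecture-24833`), route of record `HCCMUnconditional`; programme R90-TF, section S5 (base `R90-C133`).  PROOF lane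
(`--supports stmt-HodgeConjecture-24833 --as helper`): theorems only; Lines-free.

THE POINT.  Road γ (★ `R90S5XiStringOfEnvelope`) and its S10 reading (★ `R90S5GermOfEnvelopeMember`) send an envelope member `P` to the RECORD ξ-STRING `v ↦ (xiFamilyOfRecord ξ v).πn`
(print's `⊗_v πⁿ(ξ_v)`, e.v.p. `t(I_{ξ̃′})`).  This file proves the string is INJECTIVE IN `ξ` at the class level: two one-dimensional automorphic `ξ, ξ′` whose record members
agree at all but finitely many places are EQUAL.  LOCAL half (split places only — the non-split unramified members `πⁿ(ξ_v)` carry only `μ_v`, cf. census B5′): at a split `v` the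
record member is the D6 split packet's `i_G(ξ_v ⊗ μ_w ∘ det₀)` at the fixed witness `w` (★ `xiFamilyOfRecord_of_split`), whose Zelevinsky labels `(η_w ψ_w μ_w, ψ_w)` determine
`η̃_w, ψ̃_w` (★ `bc_localComponent_eq_of_mem_cmSplitPacket_members`); GLOBAL half: a Hecke character of `L` trivial on `𝕀_{L⁺}` is determined by its components at one place above
every split `v` off a finite set (★ p02 ROAD S `OneDimAutRepH.ext_of_exists_bc_localComponent_eq_of_split_of_not_mem`, weak approximation).  No trace formula.
[Rogawski1990 §13.6 Lemma 13.6.3 (b) p. 211 (distinct `ρ` give distinct e.v.p.'s `ξ_H(t(ρ))`); §14.6 p. 244; §12.2 pp. 173–174; §4.13 p. 62]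

CONTENTS (sorry-free): `xi_eq_of_record_πn_eq_of_not_mem` (off a finite `S₁`), `xi_eq_of_eventually_record_πn_eq` (cofinite), and the γ-corollary
`xi_eq_of_memXiFamily_of_eventually_clFinChoice_eq_record` («`P` in the ξ-envelope whose chosen classes are a.e. the record members of `ξ′` has `ξ = ξ′`»);
(ED. 2) `xi_eq_of_memXiFamily_of_eventually_clFinChoice_eq` — TWO envelope members `P ∈ env(ξ)`, `P′ ∈ env(ξ′)` (possibly on different automorphic measures of the same `U(H)`) with
the same chosen local classes at all but finitely many places have `ξ = ξ′` («same string ⇒ same ξ», the coherence S7's KD3 ∕ `infOf_coherent` and S9 read at class level).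
HONEST LABEL: helpers; closes no socket; REL ≠ ★ ≠ BUILT; HC_CM is proved only modulo the 7 printed citations (2 remaining named inputs: hLiu418 = stmt-HodgeConjecture-24832,
h413 = stmt-HodgeConjecture-24833) until rung 0 closes.
[cite: Rogawski1990, §13.6 Lemma 13.6.3 (b) p. 211; §14.6 p. 244; §12.2 pp. 173–174; §4.13 p. 62] [cite: Zelevinsky1980, Thm. 4.2] [cite: CasselsFrohlichANT1967, Ch. VII §4 Prop. 4.1]
-/

set_option autoImplicit false
-- the mandated namespace repeats the single-problem summit's segment (`HodgeConjecture.HodgeConjecture`)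
set_option linter.dupNamespace false

noncomputable section

open NumberField IsDedekindDomain MeasureTheory Filter
open scoped Matrix
open Literature.NumberTheory.Rogawski1990 Literature.NumberTheory.GaloisRepresentations
open Literature.NumberTheory.Automorphic Literature.NumberTheory.Automorphic.UnitaryGroup

namespace Summit.HodgeConjecture.HodgeConjecture.R90.S5

open Summit.HodgeConjecture.HodgeConjecture.Cruxes.H413
open Summit.HodgeConjecture.HodgeConjecture.Cruxes.H413.F0P3InnerFormClassificationV6
open Summit.HodgeConjecture.HodgeConjecture.Cruxes.H413.F0P3ClassTokenChoice (clFinChoice admUnitConstituents)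
open Summit.HodgeConjecture.HodgeConjecture.Cruxes.H413.F0P3XiLocalFamilyOfRecord (xiFamilyOfRecord xiFamilyOfRecord_of_split)
open Summit.HodgeConjecture.HodgeConjecture.Cruxes.H413.F0P3XiLocalLabelsOfMemXiFamily (bc_localComponent_eq_of_mem_cmSplitPacket_members)

variable (L : Type) [Field L] [NumberField L] [IsCMField L] (H : Matrix (Fin 3) (Fin 3) L)
  (hH : (H.map (cmConjRingHom L))ᵀ = H) (hHd : IsUnit H.det) (μω : HeckeCharacter L) (hμu : μω.IsUnitary)

/-- **THE RECORD ξ-STRING DETERMINES `ξ` (off a finite set).**  If the record members of `ξ` and `ξ′` agree at every finite place `v ∉ S₁` of `L⁺`, then `ξ = ξ′`: at each SPLIT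
`v ∉ S₁` both members are the D6 split packet's `πⁿ` at the fixed witness `w` (★ `xiFamilyOfRecord_of_split`), so the Zelevinsky labels give `η̃_w = η̃′_w`, `ψ̃_w = ψ̃′_w`
(★ `bc_localComponent_eq_of_mem_cmSplitPacket_members`), and weak approximation off `S₁` (★ `ext_of_exists_bc_localComponent_eq_of_split_of_not_mem`) concludes.
[cite: Rogawski1990, §13.6 Lemma 13.6.3 (b) p. 211; §12.2 pp. 173–174; §4.13 p. 62] [cite: Zelevinsky1980, Thm. 4.2] [cite: CasselsFrohlichANT1967, Ch. VII §4 Prop. 4.1] -/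
theorem xi_eq_of_record_πn_eq_of_not_mem (ξ ξ' : OneDimAutRepH L) (S₁ : Finset (HeightOneSpectrum (𝓞 ↥(maximalRealSubfield L))))
    (h : ∀ v : HeightOneSpectrum (𝓞 ↥(maximalRealSubfield L)), v ∉ S₁ →
      (xiFamilyOfRecord L H hH hHd μω hμu ξ v).πn = (xiFamilyOfRecord L H hH hHd μω hμu ξ' v).πn) : ξ = ξ' :=
  OneDimAutRepH.ext_of_exists_bc_localComponent_eq_of_split_of_not_mem S₁ fun v hv hs => by
    refine ⟨splitWitness v hs, bc_localComponent_eq_of_mem_cmSplitPacket_members hH hHd (splitWitness v hs) (splitWitness_spec v hs) ξ ξ' μω hμu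
      (c := (xiFamilyOfRecord L H hH hHd μω hμu ξ v).πn) ?_ ?_⟩
    · rw [xiFamilyOfRecord_of_split L H hH hHd μω hμu ξ v hs, LocalAPacket.mem_members_iff]
      exact Or.inl rfl
    · rw [h v hv, xiFamilyOfRecord_of_split L H hH hHd μω hμu ξ' v hs, LocalAPacket.mem_members_iff]
      exact Or.inl rfl

/-- **Cofinite form**: record members equal at all but finitely many `v` ⇒ `ξ = ξ′`. [cite: Rogawski1990, §13.6 Lemma 13.6.3 (b) p. 211; §14.6 p. 244] -/
theorem xi_eq_of_eventually_record_πn_eq (ξ ξ' : OneDimAutRepH L)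
    (h : ∀ᶠ v : HeightOneSpectrum (𝓞 ↥(maximalRealSubfield L)) in cofinite,
      (xiFamilyOfRecord L H hH hHd μω hμu ξ v).πn = (xiFamilyOfRecord L H hH hHd μω hμu ξ' v).πn) : ξ = ξ' := by
  have hfin := Filter.eventually_cofinite.1 h
  exact xi_eq_of_record_πn_eq_of_not_mem L H hH hHd μω hμu ξ ξ' hfin.toFinset fun v hv => by
    by_contra hne
    exact hv (hfin.mem_toFinset.2 hne)

/-- **γ-COROLLARY: an envelope member whose chosen classes are a.e. the record members of `ξ′` has `ξ = ξ′`.**  For `P` in the ξ-envelope (`MemXiFamily`, `μ|𝕀_{L⁺} = ω`, spherical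
supply `hsph`), road γ gives `clFinChoice P v = (xiFamilyOfRecord ξ v).πn` a.e. (★ `xiString_eventually_clFinChoice_eq_recordπn_of_baseChange`); if also
`clFinChoice P v = (xiFamilyOfRecord ξ′ v).πn` a.e., the two record strings agree a.e. and `ξ = ξ′`. [cite: Rogawski1990, §14.6 p. 244; Thm. 13.3.5 p. 202] -/
theorem xi_eq_of_memXiFamily_of_eventually_clFinChoice_eq_record
    (μ : Measure (Gp L H).automorphicQuotient) [(Gp L H).IsAutomorphicMeasure μ]
    (hμω : ∀ x : Literature.NumberTheory.GaloisRepresentations.ideleGroup ↥(maximalRealSubfield L),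
      μω (AdeleRing.ideleBaseChange (↥(maximalRealSubfield L)) L x) = quadraticHeckeCharCM L x)
    (P : DiscreteAutomorphicRep (Gp L H) μ) (ξ ξ' : OneDimAutRepH L) (hmem : MemXiFamily P hH hHd μω hμu ξ)
    (hsph : ∀ᶠ v : HeightOneSpectrum (𝓞 ↥(maximalRealSubfield L)) in cofinite,
      ∃ c ∈ admUnitConstituents P v, c.IsSpherical (cmLocalIntegralLevel L 3 H v))
    (h' : ∀ᶠ v : HeightOneSpectrum (𝓞 ↥(maximalRealSubfield L)) in cofinite,
      clFinChoice P v = (xiFamilyOfRecord L H hH hHd μω hμu ξ' v).πn) : ξ = ξ' :=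
  xi_eq_of_eventually_record_πn_eq L H hH hHd μω hμu ξ ξ'
    (((xiString_eventually_clFinChoice_eq_recordπn_of_baseChange L H hH hHd μω hμu μ hμω P ξ hmem hsph).and h').mono
      fun _ hv => hv.1.2.2.symm.trans hv.2)

/-- **SAME STRING ⇒ SAME ξ (two envelope members).**  If `P` lies in the ξ-envelope and `P′` in the ξ′-envelope (each with its spherical supply; `P′` may live on another automorphic
measure of the same `U(H)`), and their chosen local classes agree at all but finitely many places, then `ξ = ξ′`: road γ for `P′` (★ `xiString_eventually_clFinChoice_eq_recordπn_of_baseChange`)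
turns the hypothesis into «`clFinChoice P v = (record ξ′ v).πn` a.e.», and `xi_eq_of_memXiFamily_of_eventually_clFinChoice_eq_record` concludes.
[cite: Rogawski1990, Thm. 13.3.5 p. 202; §14.6 p. 244; Lemma 13.6.3 (b) p. 211] -/
theorem xi_eq_of_memXiFamily_of_eventually_clFinChoice_eq
    (μ : Measure (Gp L H).automorphicQuotient) [(Gp L H).IsAutomorphicMeasure μ]
    (μ' : Measure (Gp L H).automorphicQuotient) [(Gp L H).IsAutomorphicMeasure μ']
    (hμω : ∀ x : Literature.NumberTheory.GaloisRepresentations.ideleGroup ↥(maximalRealSubfield L),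
      μω (AdeleRing.ideleBaseChange (↥(maximalRealSubfield L)) L x) = quadraticHeckeCharCM L x)
    (P : DiscreteAutomorphicRep (Gp L H) μ) (P' : DiscreteAutomorphicRep (Gp L H) μ') (ξ ξ' : OneDimAutRepH L)
    (hmem : MemXiFamily P hH hHd μω hμu ξ) (hmem' : MemXiFamily P' hH hHd μω hμu ξ')
    (hsph : ∀ᶠ v : HeightOneSpectrum (𝓞 ↥(maximalRealSubfield L)) in cofinite,
      ∃ c ∈ admUnitConstituents P v, c.IsSpherical (cmLocalIntegralLevel L 3 H v))
    (hsph' : ∀ᶠ v : HeightOneSpectrum (𝓞 ↥(maximalRealSubfield L)) in cofinite,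
      ∃ c ∈ admUnitConstituents P' v, c.IsSpherical (cmLocalIntegralLevel L 3 H v))
    (heq : ∀ᶠ v : HeightOneSpectrum (𝓞 ↥(maximalRealSubfield L)) in cofinite, clFinChoice P v = clFinChoice P' v) : ξ = ξ' :=
  xi_eq_of_memXiFamily_of_eventually_clFinChoice_eq_record L H hH hHd μω hμu μ hμω P ξ ξ' hmem hsph
    ((heq.and (xiString_eventually_clFinChoice_eq_recordπn_of_baseChange L H hH hHd μω hμu μ' hμω P' ξ' hmem' hsph')).mono
      fun _ hv => hv.1.trans hv.2.2.2)

end Summit.HodgeConjecture.HodgeConjecture.R90.S5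

end
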